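import Summits.CriticalPhenomena.PercolationContinuityZ3.Theorems.PercNearOneGluingNoHeavyLowerTailMixCSHPeelTools
import Summits.CriticalPhenomena.PercolationContinuityZ3.Theorems.PercNearOneGluingAdditiveGluingCSHHpart
import HarnessLib

/-!
# The MIXED conditioned slack hierarchy (hub observer) — THEOREM M2 from THEOREM M1:
# the mixed pre-FKG peeling with the relay-graph designation

Support file (`--supports stmt-CriticalPhenomena-4575`), prover `prim-ineq-gen-7` (gen 8).  No definitions, no named facts, no sorries.
Memo `prim-ineq-gen-7/PROOF-Q9-MIXED-CSH.md` §4 (Theorem M2), roadmap §9.4.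

Kozma–Nitzan's QUESTION 9 designates the minimiser `c` of the means `m^H_a = E_H F(C_a)` in the RELAY graph `H` while the observer is a hub
glued to `Σ ⊆ V(H)`.  The pure peeling `PreFKGSurplus.preMargin_nonneg_of_csh` (designation by the minimiser in the observer's own graph)
breaks at the step `J = (m_k − m_c) − Δ_k ≥ −Δ_k`.  With the hub observer and `H`-conditioning the same induction closes:

* `MixCSH.mixPreMargin_nonneg_of_mixCSH` — THEOREM M2: for every weight vector with `w < 1` on every pair, every hub set `Σ`, label `o` and
  observer `v`, IF the mixed hierarchy `MixCSH.MixCSHHolds w Σ x Y D o v` holds for all owners / avoided sets / decoy lists (Theorem M1 of the memo;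
  hypothesis `hMix`, the analogue of `hCSH`), THEN for every relay set `X`, every `c ∈ X` with `E F(C c) ≤ E F(C a)` (`a ∈ X`), every decoy
  list and every monotone `F`:  `0 ≤ MixCSH.mixPreMargin w Σ X c D o v F`.  At `D = []` this is `Δ^G_o(X) ≥ p·Δ^H_v(X)` (hub form), whence
  Question 9 (file `…KNQuestion9OfMixCSH.lean`).
Proof = the pure peeling with three changes, all at the `o`-entry of the level form (which has coefficient `+1`, `MixCSH.cshMarg_single_label`):
the peel identity becomes `≥` (`F(C_Σ) ≥ F(C_k)` on the new part `hubEv Σ k X'`), the tower identity becomes `≥` (`MixCSH.setIntegral_hub_sub_ge_projFun`),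
and Lemma AC acquires the extra nonnegative term `μ(D_k)·μ(D_k ∩ hubEv ∩ {C_k = ∅})`.  The only use of the designation is `m^H_c ≤ m^H_k`.
[cite: KozmaNitzan2024, Question 9 (§5.5 p. 36), Conj. 4 (p. 32)] [cite: VandenbergHaggstromKahn2005, Thm. 1.3 (p. 6), §2.1 Lemma 2.4 (p. 10)]
-/

noncomputable section

namespace Summit.CriticalPhenomena.PercolationContinuityZ3.Theorems

open MeasureTheory Set Literature.Probability.LatticeModels Literature.Probability.Percolation
open scoped Classical
open KNPreFKG CSH PreFKGSurplus

namespace MixCSH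

variable {n : ℕ}

/-- **THEOREM M2 from THEOREM M1 — the mixed pre-FKG surplus margin is nonnegative.**  Weights `< 1` on every pair; hub set `Σ`, label `o`,
second observer `v ≠ o`; the mixed hierarchy `MixCSHHolds` available for every owner / avoided set / decoy list (hypothesis `hMix`).  Then for every
relay set `X`, every `c ∈ X` with `E F(C c) ≤ E F(C a)` for all `a ∈ X`, every decoy list `D` and every monotone `F`:
`0 ≤ mixPreMargin w Σ X c D o v F`. [cite: KozmaNitzan2024, Question 9 (§5.5 p. 36), Conj. 4 (p. 32)] [cite: VandenbergHaggstromKahn2005, §2.1 Lemma 2.4 (p. 10)] -/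
theorem mixPreMargin_nonneg_of_mixCSH (w : Sym2 (Fin n) → unitInterval) (hw : ∀ e, w e < 1) (Sig : Set (Fin n)) (o v : Fin n)
    (hov : o ≠ v)
    (hMix : ∀ (x : Fin n) (Y : Finset (Fin n)) (D : List (Fin n)),
      x ∉ Y → o ≠ x → v ≠ x → o ∉ Y → v ∉ Y → D.Nodup → (∀ d ∈ D, d ≠ x ∧ d ∉ Y ∧ d ≠ o ∧ d ≠ v) →
      MixCSHHolds w Sig x (↑Y : Set (Fin n)) D o v) :
    ∀ (X : Finset (Fin n)) (c : Fin n) (D : List (Fin n)) (F : Set (Fin n) → ℝ),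
      (∀ S S' : Set (Fin n), S ⊆ S' → F S ≤ F S') → c ∈ X →
      (∀ a ∈ X, ∫ ω, F (openCluster ω c) ∂(prodBernoulli w) ≤ ∫ ω, F (openCluster ω a) ∂(prodBernoulli w)) →
      o ∉ X → v ∉ X → D.Nodup → (∀ d ∈ D, d ∉ X ∧ d ≠ o ∧ d ≠ v) →
      0 ≤ mixPreMargin w Sig X c D o v F := by
  classical
  have main : ∀ (N : ℕ) (X : Finset (Fin n)) (c : Fin n) (D : List (Fin n)) (F : Set (Fin n) → ℝ), X.card = N →
      (∀ S S' : Set (Fin n), S ⊆ S' → F S ≤ F S') → c ∈ X →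
      (∀ a ∈ X, ∫ ω, F (openCluster ω c) ∂(prodBernoulli w) ≤ ∫ ω, F (openCluster ω a) ∂(prodBernoulli w)) →
      o ∉ X → v ∉ X → D.Nodup → (∀ d ∈ D, d ∉ X ∧ d ≠ o ∧ d ≠ v) →
      0 ≤ mixPreMargin w Sig X c D o v F := by
    intro N
    induction N using Nat.strong_induction_on with
    | _ N ih =>
    intro X c D F hN hF hcX hcmin hoX hvX hD hDX
    set μ := prodBernoulli w with hμ
    have hmeas : ∀ S : Set (BondConfig (Fin n)), MeasurableSet S := fun _ => MeasurableSet.of_discrete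
    have hint : ∀ (g : BondConfig (Fin n) → ℝ), Integrable g μ := fun g => Integrable.of_finite
    have hoc : o ≠ c := fun h => hoX (h ▸ hcX)
    -- the mixed pre-FKG functional as a function of the relay set
    set PS : Finset (Fin n) → (Fin n → ℝ) := fun Y => mixPreF w Sig o Y c F with hPS
    rcases (X.erase c).eq_empty_or_nonempty with h0 | hne
    · -- base: `X = {c}`: every entry vanishes
      have hXc : X = {c} := by
        rw [← Finset.insert_erase hcX, h0]; rfl
      have hzero : PS X = fun _ => 0 := by
        funext u
        simp only [hPS, hXc]
        by_cases hu : u = o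
        · rw [hu, mixPreF_hub]
          refine le_antisymm ?_ ?_
          · refine le_of_le_of_eq (setIntegral_nonpos (hmeas _) fun ω hω => ?_) rfl
            obtain ⟨σ, hσ, a, ha, haσ⟩ := hω
            rw [Finset.mem_singleton] at ha
            subst ha
            rw [if_pos ⟨σ, hσ, haσ⟩, sub_nonpos]
            exact hF _ _ subset_union_right
          · refine setIntegral_nonneg (hmeas _) fun ω hω => ?_
            obtain ⟨σ, hσ, a, ha, haσ⟩ := hω
            rw [Finset.mem_singleton] at ha
            subst ha
            rw [if_pos ⟨σ, hσ, haσ⟩, sub_nonneg]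
            refine hF _ _ fun z hz => ?_
            rcases hz with hz | hz
            · exact mem_iUnion₂.2 ⟨σ, hσ, haσ.symm.trans hz⟩
            · exact hz
        · rw [mixPreF_of_ne w Sig hu]
          have hU : (⋃ a ∈ ({c} : Finset (Fin n)), (openConn u a : Set (BondConfig (Fin n)))) = openConn u c := by
            ext ω; simp
          rw [hU]
          rw [setIntegral_congr_fun (hmeas _) (g := fun _ => (0 : ℝ)) (fun ω hω => by
            show F (openCluster ω u) - F (openCluster ω c) = 0
            rw [openCluster_eq_of_reach (show (openGraph ω).Reachable u c from hω), sub_self])]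
          simp
      show 0 ≤ cshMarg _ _ o v (PS X)
      rw [hzero]
      simp only [cshMarg]
      rw [show (fun _ : Fin n => (0 : ℝ)) = (0 : Fin n → ℝ) from rfl, slForm_zero]
      simp
    -- step: peel some `k ∈ X`, `k ≠ c`
    obtain ⟨k, hk⟩ := hne
    have hkc : k ≠ c := (Finset.mem_erase.1 hk).1
    have hkX : k ∈ X := (Finset.mem_erase.1 hk).2
    set X' : Finset (Fin n) := X.erase k with hX'
    have hXcard : X'.card < N := by
      rw [hX', Finset.card_erase_of_mem hkX]; have := Finset.card_pos.2 ⟨k, hkX⟩; omega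
    have hX'X : ∀ a ∈ X', a ∈ X := fun a ha => Finset.mem_of_mem_erase ha
    have hkX' : k ∉ X' := Finset.notMem_erase k X
    have hcX' : c ∈ X' := Finset.mem_erase.2 ⟨hkc.symm, hcX⟩
    have hko : o ≠ k := fun h => hoX (h ▸ hkX)
    have hkv : v ≠ k := fun h => hvX (h ▸ hkX)
    have hkD : k ∉ D := fun h => (hDX k h).1 hkX
    have hmk : ∫ ω, F (openCluster ω c) ∂μ ≤ ∫ ω, F (openCluster ω k) ∂μ := hcmin k hkX
    -- the objects
    set Dk : Set (BondConfig (Fin n)) := {ω : BondConfig (Fin n) | ∀ a ∈ (↑X' : Set (Fin n)), ¬ (openGraph ω).Reachable k a}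
      with hDk
    set Hk : Set (BondConfig (Fin n)) := hubEv Sig k (↑X' : Set (Fin n)) with hHk
    set gk : BondConfig (Fin n) → ℝ := fun ω => F (openCluster ω k) - F (openCluster ω c) with hgk
    set L := mixDecoyList w Sig o (↑X : Set (Fin n)) D with hL
    set p : ℝ := mixObsConst w Sig v ((↑X : Set (Fin n)) ∪ {d | d ∈ D}) with hp
    set ck : Fin n → ℝ := mixAvoidConst w Sig o k (↑X' : Set (Fin n)) with hck
    have hLo : ∀ dc ∈ L, dc.1 ≠ o := fun dc hdc h => (hDX dc.1 (mem_mixDecoyList w Sig o _ D dc hdc)).2.1 h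
    have hLk : ∀ dc ∈ L, dc.1 ≠ k := fun dc hdc h => hkD (h ▸ mem_mixDecoyList w Sig o _ D dc hdc)
    -- the projected monotone functional of the peeled relay (benchmark `c`)
    set Gk : Set (Sym2 (Fin n)) → ℝ := fun K => F {z | z = k ∨ ∃ e ∈ K, z ∈ e} -
      ∫ η, F (openCluster (η \ BHK2006.barOf {k} K) c) ∂μ with hGk
    have hGk_mono : Monotone Gk := CovTau.monotone_projFun w c k F hF
    -- the projected peeled term (hub entry through `hubEv`)
    set Tk : Fin n → ℝ := fun u => if u = o then ∫ ω in Dk ∩ Hk, Gk (openEdgeCluster ω k) ∂μ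
      else ∫ ω in Dk ∩ openConn k u, Gk (openEdgeCluster ω k) ∂μ with hTk
    set J : ℝ := ∫ ω in Dk, gk ω ∂μ with hJ
    -- positivity of the conditioning events (weights `< 1`)
    have hempty_Dk : (∅ : BondConfig (Fin n)) ∈ Dk := by
      intro a ha h
      rw [HullPort.reachable_empty_iff] at h
      exact hkX' (h ▸ (Finset.mem_coe.1 ha))
    have hDkpos : 0 < μ.real Dk := prodBernoulli_real_pos_of_empty_mem w hw hempty_Dk
    have hisopos : 0 < μ.real (Dk ∩ {ω | openEdgeCluster ω k = ∅}) :=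
      prodBernoulli_real_pos_of_empty_mem w hw ⟨hempty_Dk, subset_empty_iff.1 (openEdgeCluster_subset ∅ k)⟩
    -- set identities between the systems `(X; D)`, `(X'; k; D)` and `(X'; k :: D)`
    have hins : insert k (↑X' : Set (Fin n)) = ↑X := by
      rw [hX', Finset.coe_erase, insert_sdiff_singleton, insert_eq_of_mem (Finset.mem_coe.2 hkX)]
    have hset2 : (↑X' : Set (Fin n)) ∪ {d | d ∈ k :: D} = (↑X : Set (Fin n)) ∪ {d | d ∈ D} := by
      ext a
      simp only [mem_union, Finset.mem_coe, hX', Finset.mem_erase, mem_setOf_eq, List.mem_cons]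
      constructor
      · rintro (⟨_, ha⟩ | rfl | ha)
        · exact Or.inl ha
        · exact Or.inl hkX
        · exact Or.inr ha
      · rintro (ha | ha)
        · by_cases hak : a = k
          · exact Or.inr (Or.inl hak)
          · exact Or.inl ⟨hak, ha⟩
        · exact Or.inr (Or.inr ha)
    have hmixMargin : ∀ f : Set (Sym2 (Fin n)) → ℝ,
        mixCshMargin w Sig k (↑X' : Set (Fin n)) D o v f = cshMarg L p o v (mixCovD w Sig o k (↑X' : Set (Fin n)) f) := by
      intro f
      rw [mixCshMargin, hins]
    have hnext : cshMarg (mixDecoyList w Sig o (↑X' : Set (Fin n)) (k :: D)) (mixObsConst w Sig v ((↑X' : Set (Fin n)) ∪ {d | d ∈ k :: D}))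
        o v (PS X') = cshMarg L p o v (PS X') - PS X' k * cshMarg L p o v ck := by
      rw [hset2, mixDecoyList, hins, cshMarg_cons]
    -- (1) peel `k`: equality off the hub, inequality at the hub
    have hHkDk : Hk ⊆ Dk := by
      rintro ω ⟨⟨σ, hσ, hkσ⟩, hno⟩ a ha h
      exact hno σ hσ a ha (h.symm.trans hkσ)
    have hpeel_o : PS X' o + ∫ ω in Dk ∩ Hk, gk ω ∂μ ≤ PS X o := by
      simp only [hPS, hDk, hHk, hgk, hX', hμ]
      exact mixPreF_hub_peel w Sig o X c k hkX (hX' ▸ hcX') F hF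
    have hpeel_u : ∀ u, u ≠ o → PS X u = PS X' u + ∫ ω in Dk ∩ openConn k u, gk ω ∂μ := by
      intro u hu
      simp only [hPS, mixPreF_of_ne w Sig hu]
      exact preSurplus_erase_add w X F c k u hkX
    -- (2) tower: off the hub exact (`σ(C_k)`-events), at the hub an inequality (`setIntegral_hub_sub_ge_projFun`)
    have hDk_S : ∀ u : Fin n, Dk ∩ openConn k u =
        {ω : BondConfig (Fin n) | ¬ (openGraph ω).Reachable k c} ∩
          {ω | openEdgeCluster ω k ∈ {K : Set (Sym2 (Fin n)) |
            (∀ a ∈ X', a ≠ c → ¬ (a = k ∨ ∃ e ∈ K, a ∈ e)) ∧ (u = k ∨ ∃ e ∈ K, u ∈ e)}} := by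
      intro u; ext ω
      simp only [mem_inter_iff, hDk, mem_setOf_eq, Finset.mem_coe]
      constructor
      · rintro ⟨h1, h2⟩
        refine ⟨h1 c hcX', fun a ha _ => ?_, (reachable_iff_exists_mem_openEdgeCluster ω k u).1 h2⟩
        rw [← reachable_iff_exists_mem_openEdgeCluster]; exact h1 a ha
      · rintro ⟨h1, h2, h3⟩
        refine ⟨fun a ha => ?_, (reachable_iff_exists_mem_openEdgeCluster ω k u).2 h3⟩
        by_cases hac : a = c
        · rw [hac]; exact h1
        · rw [reachable_iff_exists_mem_openEdgeCluster]; exact h2 a ha hac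
    have hDk_0 : Dk = {ω : BondConfig (Fin n) | ¬ (openGraph ω).Reachable k c} ∩
          {ω | openEdgeCluster ω k ∈ {K : Set (Sym2 (Fin n)) | ∀ a ∈ X', a ≠ c → ¬ (a = k ∨ ∃ e ∈ K, a ∈ e)}} := by
      ext ω
      simp only [mem_inter_iff, hDk, mem_setOf_eq, Finset.mem_coe]
      constructor
      · intro h1
        refine ⟨h1 c hcX', fun a ha _ => ?_⟩
        rw [← reachable_iff_exists_mem_openEdgeCluster]; exact h1 a ha
      · rintro ⟨h1, h2⟩ a ha
        by_cases hac : a = c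
        · rw [hac]; exact h1
        · rw [reachable_iff_exists_mem_openEdgeCluster]; exact h2 a ha hac
    have towU : ∀ u : Fin n, ∫ ω in Dk ∩ openConn k u, gk ω ∂μ = ∫ ω in Dk ∩ openConn k u, Gk (openEdgeCluster ω k) ∂μ := by
      intro u
      simp only [hgk]
      rw [hDk_S u]
      exact CovTau.setIntegral_sub_eq_projFun w c k F _
    have towO : ∫ ω in Dk ∩ Hk, Gk (openEdgeCluster ω k) ∂μ ≤ ∫ ω in Dk ∩ Hk, gk ω ∂μ := by
      simp only [hgk, hGk, hHk, hDk]
      exact setIntegral_hub_sub_ge_projFun w Sig c k (↑X' : Set (Fin n)) (Finset.mem_coe.2 hcX') F hF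
    have tow0 : J = ∫ ω in Dk, Gk (openEdgeCluster ω k) ∂μ := by
      simp only [hJ, hgk]
      rw [hDk_0]
      exact CovTau.setIntegral_sub_eq_projFun w c k F _
    -- the total `J = (m_k − m_c) − Δ_k(X')`
    have hJtot : J = ((∫ ω, F (openCluster ω k) ∂μ) - ∫ ω, F (openCluster ω c) ∂μ) - PS X' k := by
      have h1 := integral_add_compl (hmeas Dk) (hint gk)
      have hDkc : Dkᶜ = ⋃ a' ∈ X', (openConn k a' : Set (BondConfig (Fin n))) := by
        ext ω
        rw [mem_iUnion_openConn, mem_compl_iff, hDk]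
        simp only [mem_setOf_eq, Finset.mem_coe, not_forall, not_not, exists_prop]
      have h2 : ∫ ω in Dkᶜ, gk ω ∂μ = PS X' k := by
        rw [hDkc]; simp only [hPS, hgk, hμ, mixPreF_of_ne w Sig hko.symm]
      have h3 : ∫ ω, gk ω ∂μ = (∫ ω, F (openCluster ω k) ∂μ) - ∫ ω, F (openCluster ω c) ∂μ := by
        rw [hgk, integral_sub (hint _) (hint _)]
      rw [hJ]; linarith
    -- (1)+(2): `Marg[PS X] ≥ Marg[PS X' + Tk]` (monotonicity in the `o`-entry, equality elsewhere)
    have hstep12 : cshMarg L p o v (PS X' + Tk) ≤ cshMarg L p o v (PS X) := by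
      refine cshMarg_mono_label L p hov hLo (PS X) (PS X' + Tk) ?_ ?_
      · rw [Pi.add_apply]
        simp only [hTk, if_pos rfl]
        linarith [hpeel_o, towO]
      · intro u hu
        rw [Pi.add_apply, hpeel_u u hu, towU u]
        simp only [hTk, if_neg hu]
    -- (2') the projected peeled term through `mixCovD`:  `μ(Dk)•Tk = mixCovD(Gk) + J•(μ(Dk)•ck)`
    have hTk_cov : (μ.real Dk) • Tk = mixCovD w Sig o k (↑X' : Set (Fin n)) Gk + J • ((μ.real Dk) • ck) := by
      funext u
      simp only [Pi.add_apply, Pi.smul_apply, smul_eq_mul]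
      by_cases hu : u = o
      · subst hu
        have h2 : μ.real (Dk ∩ Hk) = μ.real Dk * ck u := by
          simp only [hck, mixAvoidConst_hub, hDk, hHk]
          rw [mul_div_cancel₀ _ (ne_of_gt hDkpos)]
        simp only [hTk, if_pos rfl]
        rw [mixCovD_hub, ← hDk, ← hHk, ← tow0, h2]
        ring
      · have h2 : μ.real (Dk ∩ openConn k u) = μ.real Dk * ck u := by
          simp only [hck, mixAvoidConst_of_ne w Sig hu, avoidConst, hDk]
          rw [mul_div_cancel₀ _ (ne_of_gt hDkpos)]
        simp only [hTk, if_neg hu]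
        rw [mixCovD_of_ne w Sig hu]
        unfold CSH.covD
        rw [← hDk, ← tow0, h2]
        ring
    -- (3) the mixed hierarchy for the peeled relay, functional `Gk`
    have hMixk := hMix k X' D hkX' hko hkv (fun h => hoX (hX'X o h)) (fun h => hvX (hX'X v h)) hD
      (fun d hd => ⟨fun h => hkD (h ▸ hd), fun h => (hDX d hd).1 (hX'X d h), (hDX d hd).2.1, (hDX d hd).2.2⟩)
    have h3 : 0 ≤ cshMarg L p o v (mixCovD w Sig o k (↑X' : Set (Fin n)) Gk) := by
      rw [← hmixMargin]
      exact hMixk Gk hGk_mono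
    -- (4) Lemma AC, mixed: `Marg[c_k] ≥ 0` from the hierarchy applied to `Ψ_iso` (with the extra hub term)
    have h4 : 0 ≤ cshMarg L p o v ck := by
      have hiso := hMixk psiIso psiIso_mono
      rw [hmixMargin] at hiso
      set a : ℝ := μ.real (Dk ∩ {ω | openEdgeCluster ω k = ∅}) * μ.real Dk with ha
      set b : ℝ := μ.real Dk * μ.real (Dk ∩ Hk ∩ {ω | openEdgeCluster ω k = ∅}) with hb
      have hb0 : 0 ≤ b := mul_nonneg hDkpos.le measureReal_nonneg
      have hrepr : cshMarg L p o v (mixCovD w Sig o k (↑X' : Set (Fin n)) psiIso) =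
          cshMarg L p o v (a • ck - b • Pi.single o (1 : ℝ)) := by
        refine cshMarg_congr L p o v _ _ (fun u => u ≠ k) hLk hko hkv fun u hu => ?_
        simp only [Pi.sub_apply, Pi.smul_apply, smul_eq_mul]
        by_cases huo : u = o
        · subst huo
          rw [Pi.single_eq_same, mul_one, mixCovD_hub, ← hDk, ← hHk, setIntegral_psiIso, setIntegral_psiIso]
          simp only [hck, mixAvoidConst_hub, ← hDk, ← hHk, ha, hb]
          rw [show μ.real (Dk ∩ {ω | openEdgeCluster ω k = ∅}) * μ.real Dk * (μ.real (Dk ∩ Hk) / μ.real Dk) =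
            μ.real (Dk ∩ {ω | openEdgeCluster ω k = ∅}) * μ.real (Dk ∩ Hk) by
              rw [mul_assoc, mul_div_cancel₀ _ (ne_of_gt hDkpos)]]
          ring
        · rw [Pi.single_eq_of_ne huo, mul_zero, sub_zero, mixCovD_of_ne w Sig huo, covD_psiIso w X' k u hu]
          simp only [hck, mixAvoidConst_of_ne w Sig huo, avoidConst, hDk, ha]
          rw [mul_assoc, mul_div_cancel₀ _ (ne_of_gt hDkpos)]
      rw [hrepr, cshMarg_sub, cshMarg_smul, cshMarg_smul, cshMarg_single_label L p hov hLo, mul_one] at hiso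
      have hapos : 0 < a := mul_pos hisopos hDkpos
      nlinarith [hiso, hb0, hapos]
    -- (5) the replacement of Lemma κ: `J ≥ −Δ_k(X')` (only use of `m_c ≤ m_k`)
    have h5 : -PS X' k ≤ J := by rw [hJtot]; linarith [hmk]
    -- (6) the next rung by induction
    have h6 : 0 ≤ cshMarg (mixDecoyList w Sig o (↑X' : Set (Fin n)) (k :: D))
        (mixObsConst w Sig v ((↑X' : Set (Fin n)) ∪ {d | d ∈ k :: D})) o v (PS X') :=
      ih X'.card hXcard X' c (k :: D) F rfl hF hcX' (fun a ha => hcmin a (hX'X a ha)) (fun h => hoX (hX'X o h))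
        (fun h => hvX (hX'X v h)) (List.nodup_cons.2 ⟨hkD, hD⟩)
        (fun d hd => by
          rcases List.mem_cons.1 hd with rfl | hd
          · exact ⟨hkX', hko.symm, hkv.symm⟩
          · exact ⟨fun h => (hDX d hd).1 (hX'X d h), (hDX d hd).2.1, (hDX d hd).2.2⟩)
    -- (7) assemble
    have hmain : μ.real Dk * cshMarg L p o v (PS X' + Tk) =
        μ.real Dk * cshMarg L p o v (PS X') + cshMarg L p o v (mixCovD w Sig o k (↑X' : Set (Fin n)) Gk) +
          J * μ.real Dk * cshMarg L p o v ck := by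
      have e1 : μ.real Dk * cshMarg L p o v Tk =
          cshMarg L p o v (mixCovD w Sig o k (↑X' : Set (Fin n)) Gk) + J * μ.real Dk * cshMarg L p o v ck := by
        rw [← cshMarg_smul, hTk_cov, cshMarg_add, cshMarg_smul, cshMarg_smul]; ring
      rw [cshMarg_add, mul_add, e1]
      ring
    have hbound : μ.real Dk * cshMarg (mixDecoyList w Sig o (↑X' : Set (Fin n)) (k :: D))
        (mixObsConst w Sig v ((↑X' : Set (Fin n)) ∪ {d | d ∈ k :: D})) o v (PS X') ≤ μ.real Dk * cshMarg L p o v (PS X' + Tk) := by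
      rw [hmain, hnext]
      have := mul_le_mul_of_nonneg_right h5 (mul_nonneg hDkpos.le h4)
      nlinarith [h3, h4, this, hDkpos.le]
    show 0 ≤ cshMarg L p o v (PS X)
    have hfin : 0 ≤ μ.real Dk * cshMarg L p o v (PS X' + Tk) := by linarith [mul_nonneg hDkpos.le h6]
    exact (le_of_mul_le_mul_left (by linarith [hfin]) hDkpos : (0 : ℝ) ≤ cshMarg L p o v (PS X' + Tk)).trans hstep12
  intro X c D F hF hcX hcmin hoX hvX hD hDX
  exact main X.card X c D F rfl hF hcX hcmin hoX hvX hD hDX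

end MixCSH

end Summit.CriticalPhenomena.PercolationContinuityZ3.Theorems
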